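import Summits.SmoothPoincare4.SmoothPoincare4.Theorems.DottedCircleRasmussenDcrGapHelperFriendsCarrierVkDiscBand
import Summits.SmoothPoincare4.SmoothPoincare4.Theorems.DottedCircleRasmussenDcrGapHelperFriendsCarrierVkDiscTube
import Literature.Topology.FourManifolds.SliceDiscConicalFramingExistence

/-!
# Helper `helper_friendsCarrier_Vk_partB_rayRadius` (piece of the registered stub
`helper_friendsCarrier_Vk_partB`, line `mk_friends`, skeleton v8) for crux `DcrGap`
(item stmt-SmoothPoincare4-16128, route route-SmoothPoincare4-DottedCircleRasmussen)

**The level-parametrised radius of the slice disc near its boundary circle, as a smooth function.**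
For a neat model slice disc `f₁` of the model knot `K₁`, the neat-adapted clock field `V`
(`…VkAdaptedFieldNeat`: `V(f₁(t u)) = (d(G_k ∘ f₁)(t u) u)⁻¹ df₁(t u) u` near the circle) and a `C^∞`
flow `Φ` of `V`, the flow line from `K₁ u = f₁ u` is the disc ray through `u`
(`…VkDiscFlowLinesNeat`): `Φ(s, f₁ u) = f₁(r u)` with `G_k(f₁(r u)) = 1 + s`.  This file turns the
radius `r` into a function on the plane: there are `τ ∈ (0, 1/2]` and `ρ : ℝ² → ℝ`, `C^∞` on the
annulus `|‖x‖ - 1| < τ`, with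

* `f₁(ρ(x) x/‖x‖) = Φ(1 - ‖x‖, f₁(x/‖x‖))`, `G_k(f₁(ρ(x) x/‖x‖)) = 2 - ‖x‖`, `|ρ x - 1| < 1/2`;
* `ρ = 1` on the unit circle;
* **the radial derivative of `ρ` is positive**: `dρₓ(x) > 0` (differentiate the level identity along
  the ray: `(G_k ∘ f₁)'_u(ρ) ∂_t ρ = -1`, and the radial clock `(G_k ∘ f₁)'_u` is negative near the
  circle by neatness).

`ρ` is read off the smooth left inverse `Finv` of the framed tube `F(x, w) = f₁ x + Σ wᵢ nᵢ x` of the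
enlarged disc (`…VkDiscTube`): `ρ(x) = ‖(Finv(Φ(1 - ‖x‖, f₁(x/‖x‖)))).1‖`.

No definitions, no named facts, no `sorry`.
-/

-- the prescribed namespace `Summit.<P>.<Sub>.…` duplicates `SmoothPoincare4` (P = Sub)
set_option linter.dupNamespace false
set_option linter.style.longLine false

noncomputable section

open scoped Manifold ContDiff Topology
open Set Function Metric Filter
open Literature.Topology.FourManifolds Literature.Topology.FourManifolds.MMSW

namespace Summit.SmoothPoincare4.SmoothPoincare4.Theorems.DcrGap.MkFriends

namespace FriendsCarrierVk

/-- A point of the annulus `|‖x‖ - 1| < τ ≤ 1/2` is nonzero, of norm in `(1/2, 3/2)`. [folklore] -/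
theorem annulus_norm {x : (EuclideanSpace ℝ (Fin 2))} {τ : ℝ} (hτ : τ ≤ 1 / 2) (hx : |‖x‖ - 1| < τ) :
    x ≠ 0 ∧ 1 / 2 < ‖x‖ ∧ ‖x‖ < 3 / 2 := by
  have h := abs_lt.1 hx
  refine ⟨fun h0 => ?_, by linarith, by linarith⟩
  rw [h0, norm_zero] at h
  linarith

/-- The unit vector of a point of the annulus is a point of the circle, and `x = ‖x‖ • unitVec x`. [folklore] -/
theorem unitVec_mem_sphere {x : (EuclideanSpace ℝ (Fin 2))} (hx : x ≠ 0) : unitVec x ∈ ((Metric.sphere (0 : EuclideanSpace ℝ (Fin 2)) 1) : Set (EuclideanSpace ℝ (Fin 2))) := by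
  simp [norm_unitVec hx]

set_option maxHeartbeats 800000 in
/-- **The level-parametrised radius as a smooth function on an annulus.** [folklore] -/
theorem exists_rayRadius (k : ℕ) {K₁ : (Metric.sphere (0 : EuclideanSpace ℝ (Fin 2)) 1) → (EuclideanSpace ℝ (Fin 4))} {f₁ : (EuclideanSpace ℝ (Fin 2)) → (EuclideanSpace ℝ (Fin 4))} {V : (EuclideanSpace ℝ (Fin 4)) → (EuclideanSpace ℝ (Fin 4))} {Φ : ℝ × (EuclideanSpace ℝ (Fin 4)) → (EuclideanSpace ℝ (Fin 4))} {R δ' : ℝ}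
    (hK : IsModelKnot k K₁) (hf : IsModelSliceDisc k K₁ f₁)
    (hneat : ∀ t : (Metric.sphere (0 : EuclideanSpace ℝ (Fin 2)) 1), deriv (fun ρ : ℝ => levelFun k (f₁ (ρ • (t : (EuclideanSpace ℝ (Fin 2)))))) 1 < 0)
    (hV : ContDiff ℝ ∞ V) (hVR : ∀ y, R ≤ ‖y‖ → V y = 0) (hδ' : 0 < δ')
    (htan : ∀ (u : (Metric.sphere (0 : EuclideanSpace ℝ (Fin 2)) 1)) (t : ℝ), 1 - δ' < t → t < 1 + δ' →
      V (f₁ (t • (u : (EuclideanSpace ℝ (Fin 2))))) = (fderiv ℝ (fun y => levelFun k (f₁ y)) (t • (u : (EuclideanSpace ℝ (Fin 2)))) (u : (EuclideanSpace ℝ (Fin 2))))⁻¹ • fderiv ℝ f₁ (t • (u : (EuclideanSpace ℝ (Fin 2)))) (u : (EuclideanSpace ℝ (Fin 2))))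
    (hΦs : ContDiff ℝ ∞ Φ) (hΦ : ∀ x s, HasDerivAt (fun s : ℝ => Φ (s, x)) (V (Φ (s, x))) s) (hΦ0 : ∀ x, Φ (0, x) = x) :
    ∃ (ρ : (EuclideanSpace ℝ (Fin 2)) → ℝ) (τ : ℝ), 0 < τ ∧ τ ≤ 1 / 2 ∧
      (∀ x : (EuclideanSpace ℝ (Fin 2)), |‖x‖ - 1| < τ → ContDiffAt ℝ ∞ ρ x ∧ |ρ x - 1| < 1 / 2 ∧ 0 < fderiv ℝ ρ x x ∧
        f₁ (ρ x • unitVec x) = Φ (1 - ‖x‖, f₁ (unitVec x)) ∧ levelFun k (f₁ (ρ x • unitVec x)) = 2 - ‖x‖) ∧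
      (∀ x : (EuclideanSpace ℝ (Fin 2)), ‖x‖ = 1 → ρ x = 1) := by
  have hfs : ContDiff ℝ ∞ f₁ := contMDiff_iff_contDiff.1 hf.1
  have himm1 : ∀ x ∈ closedBall (0 : (EuclideanSpace ℝ (Fin 2))) 1, Injective (fderiv ℝ f₁ x) := fun x hx => by
    have h := hf.2.2.1 x hx
    rwa [mfderiv_eq_fderiv] at h
  -- the framed tube of the enlarged disc and its smooth inverse
  obtain ⟨δ, η, F, Finv, hδ, hη, -, -, hF0, -, -, hUo, hFinvs, hleft⟩ := exists_discTube hfs hf.2.1 himm1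
  -- the neat zone
  obtain ⟨δ₂, hδ₂, hδ₂h, hzone⟩ := exists_neatZone k hK hf hneat
  set Gf : (EuclideanSpace ℝ (Fin 2)) → ℝ := fun y => levelFun k (f₁ y) with hGf
  have hGfat : ∀ x : (EuclideanSpace ℝ (Fin 2)), |‖x‖ - 1| < δ₂ → ContDiffAt ℝ ∞ Gf x := fun x hx =>
    (contDiffAt_levelFun fun j => (lt_trans (by norm_num) ((hzone x hx).1 j)).ne').comp x hfs.contDiffAt
  -- the flow lines are the disc rays, with radius within `δ₃` of `1`
  set δ₃ : ℝ := min δ' (min δ δ₂) with hδ₃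
  have hδ₃pos : 0 < δ₃ := lt_min hδ' (lt_min hδ hδ₂)
  have hδ₃' : δ₃ ≤ δ' := min_le_left _ _
  have hδ₃δ : δ₃ ≤ δ := (min_le_right _ _).trans (min_le_left _ _)
  have hδ₃₂ : δ₃ ≤ δ₂ := (min_le_right _ _).trans (min_le_right _ _)
  have htan' : ∀ (u : (Metric.sphere (0 : EuclideanSpace ℝ (Fin 2)) 1)) (t : ℝ), 1 - δ₃ < t → t < 1 + δ₃ →
      V (f₁ (t • (u : (EuclideanSpace ℝ (Fin 2))))) = (fderiv ℝ (fun y => levelFun k (f₁ y)) (t • (u : (EuclideanSpace ℝ (Fin 2)))) (u : (EuclideanSpace ℝ (Fin 2))))⁻¹ • fderiv ℝ f₁ (t • (u : (EuclideanSpace ℝ (Fin 2)))) (u : (EuclideanSpace ℝ (Fin 2))) :=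
    fun u t h1 h2 => htan u t (by linarith) (by linarith)
  obtain ⟨δ₀, hδ₀, hlines⟩ := flow_eq_disc_ray_neat k hK hf hneat hV hVR hδ₃pos htan' hΦ hΦ0
  -- the radius function
  set τ : ℝ := min δ₀ (1 / 2) with hτ
  have hτpos : 0 < τ := lt_min hδ₀ (by norm_num)
  have hτh : τ ≤ 1 / 2 := min_le_right _ _
  have hτδ₀ : τ ≤ δ₀ := min_le_left _ _
  set Y : (EuclideanSpace ℝ (Fin 2)) → (EuclideanSpace ℝ (Fin 4)) := fun x => Φ (1 - ‖x‖, f₁ (unitVec x)) with hY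
  set ρ : (EuclideanSpace ℝ (Fin 2)) → ℝ := fun x => ‖(Finv (Y x)).1‖ with hρ
  -- the key computation on the annulus
  have key : ∀ x : (EuclideanSpace ℝ (Fin 2)), |‖x‖ - 1| < τ → ∃ r : ℝ, |r - 1| < δ₃ ∧ 0 < r ∧ Y x = f₁ (r • unitVec x) ∧
      levelFun k (f₁ (r • unitVec x)) = 2 - ‖x‖ ∧
      ((r • unitVec x, (0 : (EuclideanSpace ℝ (Fin 2)))) : (EuclideanSpace ℝ (Fin 2)) × (EuclideanSpace ℝ (Fin 2))) ∈ ball (0 : (EuclideanSpace ℝ (Fin 2))) (1 + δ) ×ˢ ball (0 : (EuclideanSpace ℝ (Fin 2))) η ∧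
      Finv (Y x) = (r • unitVec x, 0) ∧ ρ x = r := by
    intro x hx
    obtain ⟨hx0, -, -⟩ := annulus_norm hτh hx
    set u : (Metric.sphere (0 : EuclideanSpace ℝ (Fin 2)) 1) := ⟨unitVec x, unitVec_mem_sphere hx0⟩ with hu
    have hux : (u : (EuclideanSpace ℝ (Fin 2))) = unitVec x := rfl
    have hs : |1 - ‖x‖| < δ₀ := by rw [abs_sub_comm]; exact lt_of_lt_of_le hx hτδ₀
    obtain ⟨r, hr, hΦr, hGr⟩ := hlines u (1 - ‖x‖) hs
    rw [hf.apply_sphere u] at hΦr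
    have hKu : K₁ u = f₁ (unitVec x) := by rw [← hux, hf.apply_sphere u]
    rw [hKu] at hΦr
    rw [hux] at hΦr hGr
    have hr0 : 0 < r := by have := (abs_lt.1 hr).1; linarith [hδ₃₂.trans hδ₂h]
    have hnorm : ‖r • unitVec x‖ = r := by
      rw [norm_smul, norm_unitVec hx0, mul_one, Real.norm_eq_abs, abs_of_pos hr0]
    have hmem : ((r • unitVec x, (0 : (EuclideanSpace ℝ (Fin 2)))) : (EuclideanSpace ℝ (Fin 2)) × (EuclideanSpace ℝ (Fin 2))) ∈ ball (0 : (EuclideanSpace ℝ (Fin 2))) (1 + δ) ×ˢ ball (0 : (EuclideanSpace ℝ (Fin 2))) η := by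
      refine ⟨mem_ball_zero_iff.2 ?_, by simpa using hη⟩
      rw [hnorm]; have := (abs_lt.1 hr).2; linarith
    have hFinv : Finv (Y x) = (r • unitVec x, 0) := by
      show Finv (Φ (1 - ‖x‖, f₁ (unitVec x))) = (r • unitVec x, 0)
      rw [hΦr, ← hF0, hleft _ hmem]
    refine ⟨r, hr, hr0, hΦr, ?_, hmem, hFinv, ?_⟩
    · rw [hGr]; ring
    · simp only [hρ, hFinv, hnorm]
  -- `ρ = 1` on the circle
  have hone : ∀ x : (EuclideanSpace ℝ (Fin 2)), ‖x‖ = 1 → ρ x = 1 := by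
    intro x hx1
    have hx0 : x ≠ 0 := by intro h; rw [h, norm_zero] at hx1; exact zero_ne_one hx1
    have hux : unitVec x = x := by rw [unitVec_eq hx0, hx1, inv_one, one_smul]
    have hYx : Y x = f₁ x := by simp only [hY, hx1, sub_self, hΦ0, hux]
    have hmem : ((x, (0 : (EuclideanSpace ℝ (Fin 2)))) : (EuclideanSpace ℝ (Fin 2)) × (EuclideanSpace ℝ (Fin 2))) ∈ ball (0 : (EuclideanSpace ℝ (Fin 2))) (1 + δ) ×ˢ ball (0 : (EuclideanSpace ℝ (Fin 2))) η :=
      ⟨mem_ball_zero_iff.2 (by rw [hx1]; linarith), by simpa using hη⟩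
    simp only [hρ, hYx, ← hF0 x, hleft _ hmem, hx1]
  -- smoothness on the annulus
  have hsmooth : ∀ x : (EuclideanSpace ℝ (Fin 2)), |‖x‖ - 1| < τ → ContDiffAt ℝ ∞ ρ x := by
    intro x hx
    obtain ⟨hx0, -, -⟩ := annulus_norm hτh hx
    obtain ⟨r, hr, hr0, hYr, -, hmem, hFinv, -⟩ := key x hx
    have hYs : ContDiffAt ℝ ∞ Y x :=
      hΦs.contDiffAt.comp x ((contDiffAt_const.sub (contDiffAt_norm ℝ hx0)).prodMk
        (hfs.contDiffAt.comp x (contDiffAt_unitVec hx0)))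
    have hYU : Y x ∈ F '' (ball (0 : (EuclideanSpace ℝ (Fin 2))) (1 + δ) ×ˢ ball (0 : (EuclideanSpace ℝ (Fin 2))) η) := ⟨_, hmem, by rw [hF0, hYr]⟩
    have hFi : ContDiffAt ℝ ∞ Finv (Y x) := hFinvs.contDiffAt (hUo.mem_nhds hYU)
    have h1 : ContDiffAt ℝ ∞ (fun x => (Finv (Y x)).1) x := contDiffAt_fst.comp x (hFi.comp x hYs)
    have hne : (Finv (Y x)).1 ≠ 0 := by
      rw [hFinv]
      exact smul_ne_zero hr0.ne' (by rw [← norm_ne_zero_iff, norm_unitVec hx0]; exact one_ne_zero)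
    exact h1.norm ℝ hne
  -- the radial derivative
  have hderiv : ∀ x : (EuclideanSpace ℝ (Fin 2)), |‖x‖ - 1| < τ → 0 < fderiv ℝ ρ x x := by
    intro x hx
    obtain ⟨hx0, hxlo, hxhi⟩ := annulus_norm hτh hx
    obtain ⟨r, hr, hr0, -, hlev, -, -, hρr⟩ := key x hx
    set u : (EuclideanSpace ℝ (Fin 2)) := unitVec x with hu
    set t₀ : ℝ := ‖x‖ with ht₀
    have ht₀pos : 0 < t₀ := norm_pos_iff.2 hx0
    have hxu : t₀ • u = x := norm_smul_unitVec x
    have hu1 : ‖u‖ = 1 := norm_unitVec hx0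
    -- the level function along the ray and its (negative) derivative at `r = ρ x`
    set ℓ : ℝ → ℝ := fun s => Gf (s • u) with hℓ
    have hrδ₂ : |r - 1| < δ₂ := lt_of_lt_of_le hr hδ₃₂
    have hru : |‖r • u‖ - 1| < δ₂ ∧ ‖r • u‖⁻¹ • (r • u) = u := by
      have hn : ‖r • u‖ = r := by rw [norm_smul, hu1, mul_one, Real.norm_eq_abs, abs_of_pos hr0]
      refine ⟨by rwa [hn], ?_⟩
      rw [hn, smul_smul, inv_mul_cancel₀ hr0.ne', one_smul]
    have hℓd : HasDerivAt ℓ (fderiv ℝ Gf (r • u) u) r := by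
      have hline : HasDerivAt (fun s : ℝ => s • u) u r := by simpa using (hasDerivAt_id r).smul_const u
      exact ((hGfat _ hru.1).differentiableAt (by simp)).hasFDerivAt.comp_hasDerivAt_of_eq r hline rfl
    have hℓneg : fderiv ℝ Gf (r • u) u < 0 := by
      have h := (hzone _ hru.1).2
      rwa [hru.2] at h
    -- the radius along the ray and its derivative
    set φ : ℝ → ℝ := fun t => ρ (t • u) with hφ
    have hφd : HasDerivAt φ (fderiv ℝ ρ x u) t₀ := by
      have hline : HasDerivAt (fun t : ℝ => t • u) u t₀ := by simpa using (hasDerivAt_id t₀).smul_const u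
      exact ((hsmooth x hx).differentiableAt (by simp)).hasFDerivAt.comp_hasDerivAt_of_eq t₀ hline hxu.symm
    have hφ₀ : φ t₀ = r := by simp only [hφ, hxu, hρr]
    -- the level identity along the ray near `t₀`
    have hev : (fun t => ℓ (φ t)) =ᶠ[𝓝 t₀] fun t => 2 - t := by
      have hopen : IsOpen {t : ℝ | |t - 1| < τ ∧ 0 < t} :=
        (isOpen_lt (continuous_abs.comp (continuous_id.sub continuous_const)) continuous_const).inter
          (isOpen_lt continuous_const continuous_id)
      have hmem : t₀ ∈ {t : ℝ | |t - 1| < τ ∧ 0 < t} := ⟨hx, ht₀pos⟩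
      filter_upwards [hopen.mem_nhds hmem] with t ht
      have hnt : ‖t • u‖ = t := by rw [norm_smul, hu1, mul_one, Real.norm_eq_abs, abs_of_pos ht.2]
      have htu : |‖t • u‖ - 1| < τ := by rw [hnt]; exact ht.1
      obtain ⟨r', -, -, -, hlev', -, -, hρr'⟩ := key (t • u) htu
      have hunit : unitVec (t • u) = u := by
        rw [unitVec_eq (norm_pos_iff.1 (by rw [hnt]; exact ht.2)), hnt, smul_smul, inv_mul_cancel₀ ht.2.ne', one_smul]
      rw [hunit, hnt] at hlev'
      show levelFun k (f₁ (ρ (t • u) • u)) = 2 - t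
      rw [hρr']
      exact hlev'
    have h1 : HasDerivAt (fun t => ℓ (φ t)) (fderiv ℝ Gf (r • u) u * fderiv ℝ ρ x u) t₀ := by
      have hℓd' : HasDerivAt ℓ (fderiv ℝ Gf (r • u) u) (φ t₀) := by rw [hφ₀]; exact hℓd
      exact hℓd'.comp t₀ hφd
    have h2 : HasDerivAt (fun t => ℓ (φ t)) (-1 : ℝ) t₀ := by
      have h : HasDerivAt (fun t : ℝ => 2 - t) (-1) t₀ := by simpa using (hasDerivAt_id t₀).const_sub 2
      exact h.congr_of_eventuallyEq hev
    have hprod : fderiv ℝ Gf (r • u) u * fderiv ℝ ρ x u = -1 := h1.unique h2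
    have hpos : 0 < fderiv ℝ ρ x u :=
      pos_of_mul_neg_right (by rw [hprod]; norm_num) hℓneg.le
    have : fderiv ℝ ρ x x = t₀ * fderiv ℝ ρ x u := by
      calc fderiv ℝ ρ x x = fderiv ℝ ρ x (t₀ • u) := by rw [hxu]
        _ = t₀ * fderiv ℝ ρ x u := by rw [map_smul, smul_eq_mul]
    rw [this]
    exact mul_pos ht₀pos hpos
  refine ⟨ρ, τ, hτpos, hτh, fun x hx => ⟨hsmooth x hx, ?_, hderiv x hx, ?_, ?_⟩, hone⟩
  · obtain ⟨r, hr, -, -, -, -, -, hρr⟩ := key x hx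
    rw [hρr]; exact lt_of_lt_of_le hr (hδ₃₂.trans hδ₂h)
  · obtain ⟨r, -, -, hYr, -, -, -, hρr⟩ := key x hx
    rw [hρr, ← hYr]
  · obtain ⟨r, -, -, -, hlev, -, -, hρr⟩ := key x hx
    rw [hρr, hlev]

end FriendsCarrierVk

open FriendsCarrierVk in
/-- **Helper `helper_friendsCarrier_Vk_partB_rayRadius`** (piece of the registered stub
`helper_friendsCarrier_Vk_partB`: the level-parametrised radius of the disc as a smooth function).  For a
neat model slice disc `f₁` of a model knot `K₁`, the neat-adapted field `V` and a `C^∞` flow `Φ` of `V`,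
there are `τ ∈ (0, 1/2]` and `ρ : ℝ² → ℝ`, smooth on `|‖x‖ - 1| < τ`, with `|ρ - 1| < 1/2`, positive
radial derivative, `f₁(ρ(x) x/‖x‖) = Φ(1 - ‖x‖, f₁(x/‖x‖))` at level `2 - ‖x‖`, and `ρ = 1` on the
circle. [folklore] -/
theorem helper_friendsCarrier_Vk_partB_rayRadius : ∀ (k : ℕ) (K₁ : (Metric.sphere (0 : EuclideanSpace ℝ (Fin 2)) 1) → EuclideanSpace ℝ (Fin 4)) (f₁ : EuclideanSpace ℝ (Fin 2) → EuclideanSpace ℝ (Fin 4)) (V : EuclideanSpace ℝ (Fin 4) → EuclideanSpace ℝ (Fin 4)) (Φ : ℝ × EuclideanSpace ℝ (Fin 4) → EuclideanSpace ℝ (Fin 4)) (R δ' : ℝ), IsModelKnot k K₁ → IsModelSliceDisc k K₁ f₁ → (∀ t : (Metric.sphere (0 : EuclideanSpace ℝ (Fin 2)) 1), deriv (fun ρ : ℝ => levelFun k (f₁ (ρ • (t : EuclideanSpace ℝ (Fin 2))))) 1 < 0) → ContDiff ℝ ((⊤ : ℕ∞) : WithTop ℕ∞) V → (∀ y, R ≤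 ‖y‖ → V y = 0) → 0 < δ' → (∀ (u : (Metric.sphere (0 : EuclideanSpace ℝ (Fin 2)) 1)) (t : ℝ), 1 - δ' < t → t < 1 + δ' → V (f₁ (t • (u : EuclideanSpace ℝ (Fin 2)))) = (fderiv ℝ (fun y => levelFun k (f₁ y)) (t • (u : EuclideanSpace ℝ (Fin 2))) (u : EuclideanSpace ℝ (Fin 2)))⁻¹ • fderiv ℝ f₁ (t • (u : EuclideanSpace ℝ (Fin 2))) (u : EuclideanSpace ℝ (Fin 2))) → ContDiff ℝ ((⊤ : ℕ∞) : WithTop ℕ∞) Φ → (∀ x s, HasDerivAt (fun s : ℝ => Φ (s, x)) (V (Φ (s, x))) s) → (∀ x, Φ (0, x) = x) → ∃ (ρ : EuclideanSpace ℝ (Fin 2) → ℝ) (τ : ℝ), 0 < τ ∧ τ ≤ 1 / 2 ∧ (∀ x : EuclideanSpace ℝ (Fin 2), |‖x‖ - 1| < τ → ContDiffAt ℝ ((⊤ : ℕ∞) : WithTop ℕ∞) ρ x ∧ |ρ x - 1| < 1 / 2 ∧ 0 < fderiv ℝ ρ x x ∧ f₁ (ρ x • unitVec x) = Φ (1 -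 ‖x‖, f₁ (unitVec x)) ∧ levelFun k (f₁ (ρ x • unitVec x)) = 2 - ‖x‖) ∧ (∀ x : EuclideanSpace ℝ (Fin 2), ‖x‖ = 1 → ρ x = 1) :=
  fun k _ _ _ _ _ _ hK hf hneat hV hVR hδ' htan hΦs hΦ hΦ0 => exists_rayRadius k hK hf hneat hV hVR hδ' htan hΦs hΦ hΦ0

end Summit.SmoothPoincare4.SmoothPoincare4.Theorems.DcrGap.MkFriends

end
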